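import Mathlib.Algebra.Order.Interval.Basic
import Mathlib.Order.Interval.Basic
import Mathlib.Data.Rat.Cast.Order
import Mathlib.Data.Rat.Lemmas
import Mathlib.Data.Rat.Floor
import Mathlib.Algebra.Order.Floor.Ring
import Mathlib.Data.Real.Basic
import HarnessLib

-- provenance: harness21/H21/H21/Prelude/DiophValNum/IntervalEnclosure.lean @ 12e2ffd (interim HEAD d8f2665); M5 mechanical rewrite
/-!
# Rational-endpoint interval enclosures (trunk DiophValNum, item C7)

This file is a **partial realisation** of the inventory notion `interval_arithmetic`: it provides
the *statement layer* only (sound enclosure operations on intervals with rational endpoints and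
soundness predicates for interval extensions of real functions), not a verified numerics engine.

## Contents

Mathlib already provides the type `NonemptyInterval α` of closed intervals `[fst, snd]`
(`Mathlib/Order/Interval/Basic.lean`), whose order `≤` is *containment* (`NonemptyInterval.le_def`),
membership `x ∈ I ↔ I.fst ≤ x ∧ x ≤ I.snd` (`NonemptyInterval.mem_def`), the pushforward
`NonemptyInterval.map`, and (`Mathlib/Algebra/Order/Interval/Basic.lean`) exact interval addition,
negation, subtraction (for `ℚ` via the instance `AddGroup.toOrderedSub`) and `nsmul`, together with
`NonemptyInterval.sub_mem_sub`, `NonemptyInterval.neg_mem_neg`. We use all of these.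

Mathlib's interval *multiplication* is the endpoint-wise product and assumes `MulLeftMono α`
(multiplication by *every* element is monotone), which is false for `ℚ` and `ℝ`; hence we define
the classical Moore product `NonemptyInterval.mooreMul` (min/max of the four endpoint products)
and its iterate `NonemptyInterval.moorePow`.

* `NonemptyInterval.ratCast K I`: the interval `I : NonemptyInterval ℚ` viewed in a linear ordered
  field `K` (typically `K = ℝ`), with `mem_ratCast_iff`.
* `NonemptyInterval.mooreMul`, `mul_mem_mooreMul` (Moore 1966, §2), `moorePow`, `pow_mem_moorePow`.
* `NonemptyInterval.roundOut prec I`: outward rounding of the endpoints to dyadic rationals with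
  denominator dividing `2 ^ prec` (control of coefficient growth), `le_roundOut`, `mem_roundOut`.
* `Literature.IsSoundFun f F`, `Literature.IsSoundFun₂ f F`: `F` is a sound interval extension of the real
  function `f` (the fundamental "inclusion property" of interval arithmetic), and closure lemmas.

## Design notes

* Declarations about intervals are placed in `namespace NonemptyInterval` as a deliberate
  dot-notation extension of the Mathlib namespace; the soundness predicates live in `namespace Literature`.
* Endpoints are rational (exact, decidable arithmetic, usable in certificates by `decide`/`norm_num`);
  the enclosed quantities live in an arbitrary linear ordered field `K` for the interval API and in
  `ℝ` for the soundness predicates, which is what the downstream certificate layer consumes.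

## References

* R. E. Moore, *Interval Analysis*, Prentice-Hall, 1966, Ch. 2–3 (interval operations, inclusion
  property).
* G. Irving, `girving/interval` (Lean 4 verified interval arithmetic), 2023–24 — design reference.
* `alerad/LeanCert` (certified numerical bounds in Lean 4) — design reference.
-/

open Set

namespace NonemptyInterval

/-! ### Casting rational intervals into an ordered field -/

section RatCast

variable (K : Type*) [Field K] [LinearOrder K] [IsStrictOrderedRing K]

/-- The rational interval `I = [a, b]` viewed as the interval `[(a : K), (b : K)]` in a linear
ordered field `K`; the pushforward of `I` along the order embedding `Rat.castOrderEmbedding`.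
(Moore 1966, Ch. 2; dot-notation extension of Mathlib's `NonemptyInterval`.) [cite: Moore1966, Ch. 2] -/
def ratCast (I : NonemptyInterval ℚ) : NonemptyInterval K :=
  I.map (Rat.castOrderEmbedding (K := K)).toOrderHom

variable {K}

/-- The left endpoint of `I.ratCast K` is the cast of the left endpoint of `I`. [folklore] -/
@[simp]
theorem fst_ratCast (I : NonemptyInterval ℚ) : (I.ratCast K).fst = (I.fst : K) := rfl

/-- The right endpoint of `I.ratCast K` is the cast of the right endpoint of `I`. [folklore] -/
@[simp]
theorem snd_ratCast (I : NonemptyInterval ℚ) : (I.ratCast K).snd = (I.snd : K) := rfl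

/-- Membership in a cast rational interval: `x ∈ [a, b]` iff `↑a ≤ x ≤ ↑b` (Moore 1966, Ch. 2). [cite: Moore1966, Ch. 2] -/
@[simp]
theorem mem_ratCast_iff {I : NonemptyInterval ℚ} {x : K} :
    x ∈ I.ratCast K ↔ (I.fst : K) ≤ x ∧ x ≤ I.snd :=
  Iff.rfl

/-- Casting rational intervals is monotone for containment (Moore 1966, Ch. 2). [cite: Moore1966, Ch. 2] -/
theorem ratCast_mono : Monotone (ratCast K : NonemptyInterval ℚ → NonemptyInterval K) :=
  fun _ _ h => ⟨Rat.cast_mono h.1, Rat.cast_mono h.2⟩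

/-- Containment of rational intervals transfers membership of the cast intervals. [folklore] -/
theorem mem_ratCast_of_le {I J : NonemptyInterval ℚ} (h : I ≤ J) {x : K} (hx : x ∈ I.ratCast K) :
    x ∈ J.ratCast K :=
  ⟨(Rat.cast_le.2 h.1).trans hx.1, hx.2.trans (Rat.cast_le.2 h.2)⟩

/-- Casting the point interval `[q, q]` gives the point interval `[↑q, ↑q]`. [folklore] -/
@[simp]
theorem ratCast_pure (q : ℚ) : (pure q).ratCast K = pure (q : K) := rfl

/-- A rational point lies in `I.ratCast K` iff it lies in `I`. [folklore] -/
theorem cast_mem_ratCast_iff {I : NonemptyInterval ℚ} {q : ℚ} :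
    (q : K) ∈ I.ratCast K ↔ q ∈ I := by
  rw [mem_ratCast_iff, Rat.cast_le, Rat.cast_le]
  rfl

end RatCast

/-! ### The Moore product -/

section MooreMul

variable {α : Type*} [CommRing α] [LinearOrder α]

/-- The **Moore product** of two intervals `[a, b]` and `[c, d]` in a linearly ordered commutative
ring: the interval whose endpoints are the minimum and the maximum of the four products
`a * c, a * d, b * c, b * d`. Unlike Mathlib's `NonemptyInterval` multiplication (which needs
`MulLeftMono`, false in ordered fields), this is a sound enclosure of pointwise products in `ℚ`
and `ℝ` (Moore 1966, §2.2; dot-notation extension of Mathlib's `NonemptyInterval`). [cite: Moore1966, §2.2] -/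
def mooreMul (I J : NonemptyInterval α) : NonemptyInterval α where
  fst := min (min (I.fst * J.fst) (I.fst * J.snd)) (min (I.snd * J.fst) (I.snd * J.snd))
  snd := max (max (I.fst * J.fst) (I.fst * J.snd)) (max (I.snd * J.fst) (I.snd * J.snd))
  fst_le_snd := ((min_le_left _ _).trans (min_le_left _ _)).trans
    ((le_max_left _ _).trans (le_max_left _ _))

/-- Left endpoint of the Moore product. [folklore] -/
theorem fst_mooreMul (I J : NonemptyInterval α) : (I.mooreMul J).fst =
    min (min (I.fst * J.fst) (I.fst * J.snd)) (min (I.snd * J.fst) (I.snd * J.snd)) := rfl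

/-- Right endpoint of the Moore product. [folklore] -/
theorem snd_mooreMul (I J : NonemptyInterval α) : (I.mooreMul J).snd =
    max (max (I.fst * J.fst) (I.fst * J.snd)) (max (I.snd * J.fst) (I.snd * J.snd)) := rfl

/-- The **Moore power** `I.moorePow n`: the `n`-fold iterated Moore product
`((1 · I) · I) ⋯ · I`, starting from the point interval `[1, 1]` (Moore 1966, §2.2). [cite: Moore1966, §2.2] -/
def moorePow (I : NonemptyInterval α) : ℕ → NonemptyInterval α
  | 0 => pure 1
  | n + 1 => (moorePow I n).mooreMul I

/-- `I.moorePow 0 = [1, 1]`. [folklore] -/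
@[simp]
theorem moorePow_zero (I : NonemptyInterval α) : I.moorePow 0 = pure 1 := rfl

/-- `I.moorePow (n + 1) = (I.moorePow n).mooreMul I`. [folklore] -/
theorem moorePow_succ (I : NonemptyInterval α) (n : ℕ) :
    I.moorePow (n + 1) = (I.moorePow n).mooreMul I := rfl

variable [IsOrderedRing α]

/-- If `a ≤ x ≤ b` then `min (a * y) (b * y) ≤ x * y` (case split on the sign of `y`). [folklore] -/
private theorem min_mul_le_mul {a b x : α} (y : α) (ha : a ≤ x) (hb : x ≤ b) :
    min (a * y) (b * y) ≤ x * y := by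
  rcases le_total 0 y with hy | hy
  · exact (min_le_left _ _).trans (mul_le_mul_of_nonneg_right ha hy)
  · exact (min_le_right _ _).trans (mul_le_mul_of_nonpos_right hb hy)

/-- `mul_le_max_mul` — interim theorem carried over undocumented from `harness21/H21/H21/Prelude/DiophValNum/IntervalEnclosure.lean:154` (docstring generated by the M5 import). [folklore] -/
private theorem mul_le_max_mul {a b x : α} (y : α) (ha : a ≤ x) (hb : x ≤ b) :
    x * y ≤ max (a * y) (b * y) := by
  rcases le_total 0 y with hy | hy
  · exact (mul_le_mul_of_nonneg_right hb hy).trans (le_max_right _ _)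
  · exact (mul_le_mul_of_nonpos_right ha hy).trans (le_max_left _ _)

/-- **Inclusion property of the Moore product**: if `a ∈ I` and `b ∈ J` then `a * b ∈ I.mooreMul J`
(Moore 1966, Theorem 3.1 / §2.2). [cite: Moore1966, Theorem 3.1 / §2.2] -/
theorem mul_mem_mooreMul {I J : NonemptyInterval α} {a b : α} (ha : a ∈ I) (hb : b ∈ J) :
    a * b ∈ I.mooreMul J := by
  obtain ⟨ha₁, ha₂⟩ : I.fst ≤ a ∧ a ≤ I.snd := ha
  obtain ⟨hb₁, hb₂⟩ : J.fst ≤ b ∧ b ≤ J.snd := hb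
  refine ⟨?_, ?_⟩
  · change min (min _ _) (min _ _) ≤ a * b
    refine le_trans (min_le_min ?_ ?_) (min_mul_le_mul b ha₁ ha₂)
    · simpa only [mul_comm] using min_mul_le_mul I.fst hb₁ hb₂
    · simpa only [mul_comm] using min_mul_le_mul I.snd hb₁ hb₂
  · change a * b ≤ max (max _ _) (max _ _)
    refine le_trans (mul_le_max_mul b ha₁ ha₂) (max_le_max ?_ ?_)
    · simpa only [mul_comm] using mul_le_max_mul I.fst hb₁ hb₂
    · simpa only [mul_comm] using mul_le_max_mul I.snd hb₁ hb₂

/-- The Moore product is monotone for containment in both arguments (Moore 1966, §3.1,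
"inclusion isotonicity"). [cite: Moore1966, §3.1  "inclusion isotonicity"] -/
theorem mooreMul_le_mooreMul {I I' J J' : NonemptyInterval α} (hI : I ≤ I') (hJ : J ≤ J') :
    I.mooreMul J ≤ I'.mooreMul J' := by
  have hf : I.fst ∈ I' := ⟨hI.1, I.fst_le_snd.trans hI.2⟩
  have hs : I.snd ∈ I' := ⟨hI.1.trans I.fst_le_snd, hI.2⟩
  have hf' : J.fst ∈ J' := ⟨hJ.1, J.fst_le_snd.trans hJ.2⟩
  have hs' : J.snd ∈ J' := ⟨hJ.1.trans J.fst_le_snd, hJ.2⟩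
  refine ⟨?_, ?_⟩
  · exact le_min (le_min (mul_mem_mooreMul hf hf').1 (mul_mem_mooreMul hf hs').1)
      (le_min (mul_mem_mooreMul hs hf').1 (mul_mem_mooreMul hs hs').1)
  · exact max_le (max_le (mul_mem_mooreMul hf hf').2 (mul_mem_mooreMul hf hs').2)
      (max_le (mul_mem_mooreMul hs hf').2 (mul_mem_mooreMul hs hs').2)

/-- **Inclusion property of the Moore power**: if `a ∈ I` then `a ^ n ∈ I.moorePow n`
(Moore 1966, §2.2). [cite: Moore1966, §2.2] -/
theorem pow_mem_moorePow {I : NonemptyInterval α} {a : α} (ha : a ∈ I) (n : ℕ) :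
    a ^ n ∈ I.moorePow n := by
  induction n with
  | zero => simpa only [pow_zero, moorePow_zero] using mem_pure_self (1 : α)
  | succ n ih => simpa only [pow_succ, moorePow_succ] using mul_mem_mooreMul ih ha

end MooreMul

section RatCastMul

variable {K : Type*} [Field K] [LinearOrder K] [IsStrictOrderedRing K]

/-- Casting commutes with the Moore product: the endpoints of the Moore product are polynomial
(min/max of products) in the endpoints, and `Rat.cast` is a monotone ring homomorphism. [folklore] -/
theorem ratCast_mooreMul (I J : NonemptyInterval ℚ) :
    (I.mooreMul J).ratCast K = (I.ratCast K).mooreMul (J.ratCast K) := by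
  ext <;> simp [ratCast, mooreMul, Rat.cast_mul]

/-- Casting commutes with the Moore power. [folklore] -/
theorem ratCast_moorePow (I : NonemptyInterval ℚ) (n : ℕ) :
    (I.moorePow n).ratCast K = (I.ratCast K).moorePow n := by
  induction n with
  | zero => simp only [moorePow_zero, ratCast_pure, Rat.cast_one]
  | succ n ih => rw [moorePow_succ, moorePow_succ, ratCast_mooreMul, ih]

end RatCastMul

/-! ### Outward rounding to dyadic rationals -/

section RoundOut

/-- **Outward rounding** of a rational interval to precision `prec`: the left endpoint is rounded
down and the right endpoint rounded up to the grid `2^{-prec} ℤ` of dyadic rationals,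
`[a, b] ↦ [⌊a 2^prec⌋ / 2^prec, ⌈b 2^prec⌉ / 2^prec]`. This is the standard device controlling
the size of the endpoints in iterated rational interval computations while preserving soundness
(Moore 1966, §3.2 "rounded interval arithmetic"; cf. `girving/interval`, `alerad/LeanCert`). [cite: Moore1966, §3.2 "rounded interval arithmetic"] -/
def roundOut (prec : ℕ) (I : NonemptyInterval ℚ) : NonemptyInterval ℚ where
  fst := (⌊I.fst * 2 ^ prec⌋ : ℚ) / 2 ^ prec
  snd := (⌈I.snd * 2 ^ prec⌉ : ℚ) / 2 ^ prec
  fst_le_snd := by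
    refine div_le_div_of_nonneg_right ?_ (by positivity)
    calc ((⌊I.fst * 2 ^ prec⌋ : ℤ) : ℚ) ≤ I.fst * 2 ^ prec := Int.floor_le _
      _ ≤ I.snd * 2 ^ prec := mul_le_mul_of_nonneg_right I.fst_le_snd (by positivity)
      _ ≤ ⌈I.snd * 2 ^ prec⌉ := Int.le_ceil _

/-- Left endpoint of the outward rounding. [folklore] -/
theorem fst_roundOut (prec : ℕ) (I : NonemptyInterval ℚ) :
    (I.roundOut prec).fst = (⌊I.fst * 2 ^ prec⌋ : ℚ) / 2 ^ prec := rfl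

/-- Right endpoint of the outward rounding. [folklore] -/
theorem snd_roundOut (prec : ℕ) (I : NonemptyInterval ℚ) :
    (I.roundOut prec).snd = (⌈I.snd * 2 ^ prec⌉ : ℚ) / 2 ^ prec := rfl

/-- Outward rounding enlarges the interval: `I ⊆ I.roundOut prec` (recall that `≤` on
`NonemptyInterval` is containment, `NonemptyInterval.le_def`) (Moore 1966, §3.2). [cite: Moore1966, §3.2] -/
theorem le_roundOut (prec : ℕ) (I : NonemptyInterval ℚ) : I ≤ I.roundOut prec := by
  have h2 : (0 : ℚ) < 2 ^ prec := by positivity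
  refine ⟨?_, ?_⟩
  · change (⌊I.fst * 2 ^ prec⌋ : ℚ) / 2 ^ prec ≤ I.fst
    rw [div_le_iff₀ h2]
    exact Int.floor_le _
  · change I.snd ≤ (⌈I.snd * 2 ^ prec⌉ : ℚ) / 2 ^ prec
    rw [le_div_iff₀ h2]
    exact Int.le_ceil _

/-- Soundness of outward rounding: anything enclosed by `I` is enclosed by `I.roundOut prec`
(Moore 1966, §3.2). [cite: Moore1966, §3.2] -/
theorem mem_roundOut {K : Type*} [Field K] [LinearOrder K] [IsStrictOrderedRing K] (prec : ℕ)
    {I : NonemptyInterval ℚ} {x : K} (h : x ∈ I.ratCast K) : x ∈ (I.roundOut prec).ratCast K :=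
  mem_ratCast_of_le (le_roundOut prec I) h

/-- The left endpoint of `I.roundOut prec` is a dyadic rational with denominator dividing
`2 ^ prec`. [folklore] -/
theorem den_fst_roundOut_dvd (prec : ℕ) (I : NonemptyInterval ℚ) :
    (I.roundOut prec).fst.den ∣ 2 ^ prec := by
  rw [fst_roundOut]
  have h := Rat.den_dvd ⌊I.fst * 2 ^ prec⌋ (2 ^ prec)
  rw [← Rat.intCast_div_eq_divInt] at h
  push_cast at h
  exact_mod_cast h

/-- The right endpoint of `I.roundOut prec` is a dyadic rational with denominator dividing
`2 ^ prec`. [folklore] -/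
theorem den_snd_roundOut_dvd (prec : ℕ) (I : NonemptyInterval ℚ) :
    (I.roundOut prec).snd.den ∣ 2 ^ prec := by
  rw [snd_roundOut]
  have h := Rat.den_dvd ⌈I.snd * 2 ^ prec⌉ (2 ^ prec)
  rw [← Rat.intCast_div_eq_divInt] at h
  push_cast at h
  exact_mod_cast h

end RoundOut

end NonemptyInterval

/-! ### Soundness predicates for interval extensions -/

namespace Literature.Analysis.ValidatedNumerics

open NonemptyInterval

/-- `IsSoundFun f F` says that the interval map `F` on rational intervals is a **sound interval
extension** of the real function `f`: whenever the real number `x` lies in (the real image of) `I`,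
`f x` lies in `F I`. This is the fundamental *inclusion property* of interval arithmetic
(Moore 1966, Theorem 3.1; cf. `girving/interval`, `alerad/LeanCert`). [cite: Moore1966, Theorem 3.1] -/
def IsSoundFun (f : ℝ → ℝ) (F : NonemptyInterval ℚ → NonemptyInterval ℚ) : Prop :=
  ∀ ⦃I : NonemptyInterval ℚ⦄ ⦃x : ℝ⦄, x ∈ I.ratCast ℝ → f x ∈ (F I).ratCast ℝ

/-- `IsSoundFun₂ f F` says that the binary interval map `F` is a **sound interval extension** of
the binary real function `f`: `x ∈ I → y ∈ J → f x y ∈ F I J` (Moore 1966, Theorem 3.1). [cite: Moore1966, Theorem 3.1] -/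
def IsSoundFun₂ (f : ℝ → ℝ → ℝ)
    (F : NonemptyInterval ℚ → NonemptyInterval ℚ → NonemptyInterval ℚ) : Prop :=
  ∀ ⦃I J : NonemptyInterval ℚ⦄ ⦃x y : ℝ⦄, x ∈ I.ratCast ℝ → y ∈ J.ratCast ℝ →
    f x y ∈ (F I J).ratCast ℝ

namespace IsSoundFun

variable {f g : ℝ → ℝ} {F F' G : NonemptyInterval ℚ → NonemptyInterval ℚ}

/-- Sound interval extensions compose (Moore 1966, §3.1). [cite: Moore1966, §3.1] -/
theorem comp (hg : IsSoundFun g G) (hf : IsSoundFun f F) : IsSoundFun (g ∘ f) (G ∘ F) :=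
  fun _ _ hx => hg (hf hx)

/-- A pointwise wider interval map than a sound one is sound (Moore 1966, §3.1). [cite: Moore1966, §3.1] -/
theorem mono (hF : IsSoundFun f F) (h : ∀ I, F I ≤ F' I) : IsSoundFun f F' :=
  fun I _ hx => mem_ratCast_of_le (h I) (hF hx)

/-- Outward rounding of a sound interval extension is sound (Moore 1966, §3.2). [cite: Moore1966, §3.2] -/
theorem roundOut (hF : IsSoundFun f F) (prec : ℕ) :
    IsSoundFun f (fun I ↦ (F I).roundOut prec) :=
  hF.mono fun I => le_roundOut prec (F I)

/-- The identity interval map is a sound extension of the identity. [folklore] -/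
theorem id : IsSoundFun _root_.id _root_.id := fun _ _ hx => hx

end IsSoundFun

namespace IsSoundFun₂

variable {f : ℝ → ℝ → ℝ} {g₁ g₂ : ℝ → ℝ}
  {F F' : NonemptyInterval ℚ → NonemptyInterval ℚ → NonemptyInterval ℚ}
  {G₁ G₂ : NonemptyInterval ℚ → NonemptyInterval ℚ}

/-- A pointwise wider binary interval map than a sound one is sound (Moore 1966, §3.1). [cite: Moore1966, §3.1] -/
theorem mono (hF : IsSoundFun₂ f F) (h : ∀ I J, F I J ≤ F' I J) : IsSoundFun₂ f F' :=
  fun I J _ _ hx hy => mem_ratCast_of_le (h I J) (hF hx hy)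

/-- Substituting sound unary extensions into a sound binary extension is sound
(Moore 1966, §3.1: rational interval functions are inclusion isotonic). [cite: Moore1966, §3.1: rational interval functions are in] -/
theorem comp₂ (hF : IsSoundFun₂ f F) (h₁ : IsSoundFun g₁ G₁) (h₂ : IsSoundFun g₂ G₂) :
    IsSoundFun (fun x ↦ f (g₁ x) (g₂ x)) (fun I ↦ F (G₁ I) (G₂ I)) :=
  fun _ _ hx => hF (h₁ hx) (h₂ hx)

end IsSoundFun₂

/-- Mathlib's exact interval addition is a sound extension of real addition (Moore 1966, §2.2). [cite: Moore1966, §2.2] -/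
theorem isSoundFun₂_add : IsSoundFun₂ (· + ·) (· + ·) := by
  intro I J x y hx hy
  rw [mem_ratCast_iff] at hx hy ⊢
  rw [fst_add, snd_add, Rat.cast_add, Rat.cast_add]
  exact ⟨add_le_add hx.1 hy.1, add_le_add hx.2 hy.2⟩

/-- Mathlib's exact interval subtraction `[a, b] - [c, d] = [a - d, b - c]` is a sound extension of
real subtraction (Moore 1966, §2.2). [cite: Moore1966, §2.2] -/
theorem isSoundFun₂_sub : IsSoundFun₂ (· - ·) (· - ·) := by
  intro I J x y hx hy
  rw [mem_ratCast_iff] at hx hy ⊢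
  rw [fst_sub, snd_sub, Rat.cast_sub, Rat.cast_sub]
  exact ⟨sub_le_sub hx.1 hy.2, sub_le_sub hx.2 hy.1⟩

/-- Mathlib's exact interval negation `-[a, b] = [-b, -a]` is a sound extension of real negation
(Moore 1966, §2.2). [cite: Moore1966, §2.2] -/
theorem isSoundFun_neg : IsSoundFun Neg.neg Neg.neg := by
  intro I x hx
  rw [mem_ratCast_iff] at hx ⊢
  rw [fst_neg, snd_neg, Rat.cast_neg, Rat.cast_neg]
  exact ⟨neg_le_neg hx.2, neg_le_neg hx.1⟩

/-- The Moore product is a sound extension of real multiplication (Moore 1966, Theorem 3.1). [cite: Moore1966, Theorem 3.1] -/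
theorem isSoundFun₂_mooreMul : IsSoundFun₂ (· * ·) NonemptyInterval.mooreMul := by
  intro I J x y hx hy
  rw [ratCast_mooreMul]
  exact mul_mem_mooreMul hx hy

/-- The Moore power is a sound extension of `x ↦ x ^ n` (Moore 1966, §2.2). [cite: Moore1966, §2.2] -/
theorem isSoundFun_moorePow (n : ℕ) : IsSoundFun (· ^ n) (fun I ↦ I.moorePow n) := by
  intro I x hx
  change x ^ n ∈ (I.moorePow n).ratCast ℝ
  rw [ratCast_moorePow]
  exact pow_mem_moorePow hx n

/-- The constant interval map `pure q` is a sound extension of the constant function `↑q`. [folklore] -/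
theorem isSoundFun_const (q : ℚ) : IsSoundFun (fun _ ↦ (q : ℝ)) (fun _ ↦ pure q) := by
  intro I x _
  rw [ratCast_pure]
  exact mem_pure_self _

end Literature.Analysis.ValidatedNumerics
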